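import Literature.Probability.LatticeModels.LeeYangFirstZeroMonotoneProofs
import HarnessLib

/-!
# Lee–Yang with site-dependent fields, pinned sites, `|Z_{b,-}| ≤ |Z_{b,+}|`, and `Im ⟨σ_a⟩_{iθλ} ≥ 0` on the Lee–Yang star (proofs)

Topic `Literature/Probability/LatticeModels`; sibling PROOF file in the `PairIsing` dictionary of
`UrsellMonotonicity.lean` / `LeeYangFirstZeroMonotoneProofs.lean` (finite ferromagnetic
pair interactions `c ≥ 0` on a finite set, weights `λ ≥ 0`, `X = Σ λ_x σ_x`).  Analytic inputs of
the direct route to Camia–Jiang–Newman 2023 Thm 2 recorded in `UrsellFirstZeroPinned.lean`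
(all consequences of the Lee–Yang theorem `leeYang_bool_of_nonneg` of the tree):

1. `sum_exp_fields_weight_ne_zero` — Lee–Yang for SITE-DEPENDENT complex fields `h : ι → ℂ` with
   `Re h_x > 0 ∨ h_x = 0` (transport of the tree's `Fin n → Bool` statement).
2. `sum_filter_spin_eq` — pinning one spin `σ_b = s` turns the sum into the same kind of sum on
   `ι ∖ {b}` with fields shifted by `s (c_{bx} + c_{xb})`; hence Lee–Yang for pinned sums
   (`sum_filter_spin_one_ne_zero`).
3. `norm_sum_filter_neg_le` — on the CLOSED region `Re h ≥ 0` (e.g. purely imaginary fields) the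
   `σ_b = -1` part of the Lee–Yang sum is dominated in modulus by the `σ_b = +1` part, i.e.
   `Re ⟨σ_b⟩_h ≥ 0` wherever `Z(h) ≠ 0` (open region: the zero of `t ↦ e^t W_+ + e^{-t} W_-` has
   `Re t ≤ 0`, and `W_+ ≠ 0` by (2); closed region by `ε → 0⁺`).
4. `wronskian_tilt_nonneg` — for `E(θ) = Σ_σ e^{σ_a} w e^{iθX} = U + iV` one has
   `V'U - U'V = Σ_x λ_x (|A_x|² - |B_x|²) ≥ 0` (`A_x, B_x` the `σ_x = ±1` parts), i.e. the phase of
   the `a`-tilted Lee–Yang sum is non-decreasing in `θ`.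
5. `sum_spin_mul_sin_weight_nonneg`, `avg_spin_mul_sin_nonneg` — **`⟨σ_a sin θX⟩_c ≥ 0` as long as
   `⟨cos θ'X⟩_c > 0` on `[0, θ)`** (so at the first Lee–Yang zero too): `U = cosh 1 · Z⟨cos θX⟩`,
   `V = sinh 1 · Z⟨σ_a sin θX⟩`, and `V/U` is non-decreasing from `0`.  This is the interlacing of
   the zeros of `⟨cos θX⟩` and `⟨σ_a sin θX⟩` (Hermite–Biehler for the `a`-pinned partition
   function), in the form needed at first zeros.

No definitions, no named facts.

## References

* [LeeYang1952] T. D. Lee, C. N. Yang, Phys. Rev. 87 (1952), Appendix II.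
* [LiebSokal1981] E. H. Lieb, A. D. Sokal, CMP 80 (1981), §3 (general Lee–Yang theorem; pinned /
  zero-weight sites).
* [Newman1975] C. M. Newman, CMP 41 (1975), Thm 1 (pure imaginary zeros of `⟨e^{hX}⟩`).
* [CamiaJiangNewman2023] F. Camia, J. Jiang, C. M. Newman, CMP 401 (2023), arXiv:2207.12247,
  Thm 2 and §1.2 (context: the first zero of `⟨e^{hX}⟩_c`).
-/

noncomputable section

open Finset Complex

namespace Literature.Probability.LatticeModels

namespace PairIsing

variable {ι : Type*} [Fintype ι] [DecidableEq ι]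

/-! ### 1. Lee–Yang for site-dependent complex fields -/

/-- **Generalised Lee–Yang theorem, site-dependent fields.** For couplings `c ≥ 0` and complex
fields `h_a` with `Re h_a > 0` or `h_a = 0` at every site,
`Σ_σ exp(Σ_a h_a σ_a) w_c(σ) ≠ 0`.  (Transport of `leeYang_bool_of_nonneg` to `PairIsing`
configurations, as in `sum_exp_weight_ne_zero`.) [cite: LeeYang1952, Appendix II]
[cite: LiebSokal1981, §3, Cor. 3.3] -/
theorem sum_exp_fields_weight_ne_zero {c : ι → ι → ℝ} (hc : ∀ a b, 0 ≤ c a b) (h : ι → ℂ)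
    (hh : ∀ a, 0 < (h a).re ∨ h a = 0) :
    (∑ ρ : SpinConfig ι, exp (∑ a, h a * (spinAt a ρ : ℂ)) * (weight c ρ : ℂ)) ≠ 0 := by
  classical
  have hLY := leeYang_bool_of_nonneg c h hc hh
  set Φ : SpinConfig ι ≃ (ι → Bool) :=
    { toFun := fun τ a => decide (τ a = 1)
      invFun := fun σ a => if σ a then 1 else -1
      left_inv := fun τ => funext fun a => by
        rcases Int.units_eq_one_or (τ a) with h1 | h1 <;> simp [h1]
      right_inv := fun σ => funext fun a => by
        dsimp only
        rcases Bool.eq_false_or_eq_true (σ a) with h1 | h1 <;> simp [h1] } with hΦ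
  have hΦapp : ∀ τ a, Φ τ a = decide (τ a = 1) := fun τ a => rfl
  have key : (∑ ρ : SpinConfig ι, exp (∑ a, h a * (spinAt a ρ : ℂ)) * (weight c ρ : ℂ)) =
      ∑ σ : ι → Bool, exp ((∑ a, ∑ b, ((c a b : ℂ) * (if σ a = σ b then 1 else -1))) +
        ∑ a, h a * (if σ a then 1 else -1)) := by
    refine Fintype.sum_equiv Φ _ _ fun τ => ?_
    have hQ : ∀ a, (if Φ τ a then (1 : ℂ) else -1) = (spinAt a τ : ℂ) := fun a => by
      rw [hΦapp, spinAt]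
      rcases Int.units_eq_one_or (τ a) with h1 | h1 <;> simp [h1]
    have hP : ∀ a b, (if Φ τ a = Φ τ b then (1 : ℂ) else -1) =
        (spinAt a τ : ℂ) * (spinAt b τ : ℂ) := by
      intro a b
      rw [hΦapp, hΦapp, spinAt, spinAt]
      rcases Int.units_eq_one_or (τ a) with h1 | h1 <;>
        rcases Int.units_eq_one_or (τ b) with h2 | h2 <;> simp [h1, h2]
    simp_rw [hP, hQ]
    have hexp : (∑ a, h a * (spinAt a τ : ℂ)) +
        ((∑ a, ∑ b, c a b * (spinAt a τ * spinAt b τ) : ℝ) : ℂ) =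
        (∑ a, ∑ b, (c a b : ℂ) * ((spinAt a τ : ℂ) * (spinAt b τ : ℂ))) +
          ∑ a, h a * (spinAt a τ : ℂ) := by
      rw [add_comm]
      push_cast
      rfl
    rw [weight, ofReal_exp, ← exp_add, hexp]
  rw [key]
  exact hLY

/-! ### 2. Pinning one site -/

/-- **One-site pinning identity.** The part of `Σ_σ exp(Σ_a h_a σ_a) w_c(σ)` with `σ_b = s`
(`s = ±1`) is `exp(c_bb + h_b s)` times the same kind of sum for the system on `ι ∖ {b}` with the
couplings restricted and the fields shifted by `s (c_{b a} + c_{a b})` (the pinned spin acts as a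
field on its neighbours). [folklore] -/
theorem sum_filter_spin_eq (c : ι → ι → ℝ) (h : ι → ℂ) (b : ι) (s : ℤˣ) :
    (∑ ρ ∈ univ.filter (fun ρ : SpinConfig ι => ρ b = s),
        exp (∑ a, h a * (spinAt a ρ : ℂ)) * (weight c ρ : ℂ)) =
      exp ((c b b : ℂ) + h b * ((s : ℤ) : ℂ)) *
        ∑ ρ' : SpinConfig {x // x ≠ b},
          exp (∑ a', (h a'.1 + ((s : ℤ) : ℂ) * ((c b a'.1 + c a'.1 b : ℝ) : ℂ)) *
              (spinAt a' ρ' : ℂ)) *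
            (weight (fun a' a'' : {x // x ≠ b} => c a'.1 a''.1) ρ' : ℂ) := by
  classical
  set e := Equiv.funSplitAt b ℤˣ with he
  set F : SpinConfig ι → ℂ := fun ρ => exp (∑ a, h a * (spinAt a ρ : ℂ)) * (weight c ρ : ℂ)
    with hF
  have he_b : ∀ p : ℤˣ × ({x // x ≠ b} → ℤˣ), (e.symm p) b = p.1 := by
    intro p; simp [he, Equiv.funSplitAt_symm_apply]
  have he_a : ∀ (p : ℤˣ × ({x // x ≠ b} → ℤˣ)) (a' : {x // x ≠ b}), (e.symm p) a'.1 = p.2 a' := by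
    intro p a'; simp [he, Equiv.funSplitAt_symm_apply, a'.2]
  -- step 1: re-index the filtered sum
  have h1 : (∑ ρ ∈ univ.filter (fun ρ : SpinConfig ι => ρ b = s), F ρ) =
      ∑ ρ' : SpinConfig {x // x ≠ b}, F (e.symm (s, ρ')) := by
    rw [Finset.sum_filter]
    rw [Fintype.sum_equiv e (fun ρ => if ρ b = s then F ρ else 0)
      (fun p => if (e.symm p) b = s then F (e.symm p) else 0)
      (fun ρ => by simp only [Equiv.symm_apply_apply])]
    rw [Fintype.sum_prod_type]
    simp_rw [he_b]
    rw [Finset.sum_comm]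
    refine Finset.sum_congr rfl fun ρ' _ => ?_
    rw [Finset.sum_ite_eq' univ s, if_pos (mem_univ _)]
  rw [h1, mul_sum]
  refine Finset.sum_congr rfl fun ρ' _ => ?_
  -- step 2: the pointwise identity
  set ρ : SpinConfig ι := e.symm (s, ρ') with hρ
  have hsb : spinAt b ρ = ((s : ℤ) : ℝ) := by
    rw [spinAt, hρ, he_b]
  have hsa : ∀ a' : {x // x ≠ b}, spinAt a'.1 ρ = spinAt a' ρ' := by
    intro a'; rw [spinAt, spinAt, hρ, he_a]
  have hs2 : ((s : ℤ) : ℝ) * ((s : ℤ) : ℝ) = 1 := by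
    rcases Int.units_eq_one_or s with h1 | h1 <;> simp [h1]
  -- the field part
  have hfield : (∑ a, h a * (spinAt a ρ : ℂ)) =
      h b * ((s : ℤ) : ℂ) + ∑ a' : {x // x ≠ b}, h a'.1 * (spinAt a' ρ' : ℂ) := by
    rw [Fintype.sum_eq_add_sum_subtype_ne _ b, hsb]
    push_cast
    congr 1
    exact Fintype.sum_congr _ _ fun a' => by rw [hsa]
  -- the coupling part
  have hcoup : (∑ a, ∑ a₂, c a a₂ * (spinAt a ρ * spinAt a₂ ρ)) =
      c b b + ((s : ℤ) : ℝ) * (∑ a' : {x // x ≠ b}, (c b a'.1 + c a'.1 b) * spinAt a' ρ') +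
        ∑ a' : {x // x ≠ b}, ∑ a'' : {x // x ≠ b},
          c a'.1 a''.1 * (spinAt a' ρ' * spinAt a'' ρ') := by
    rw [Fintype.sum_eq_add_sum_subtype_ne _ b]
    rw [Fintype.sum_eq_add_sum_subtype_ne _ b]
    have hinner : ∀ a' : {x // x ≠ b},
        (∑ a₂, c a'.1 a₂ * (spinAt a'.1 ρ * spinAt a₂ ρ)) =
          c a'.1 b * (spinAt a' ρ' * ((s : ℤ) : ℝ)) +
            ∑ a'' : {x // x ≠ b}, c a'.1 a''.1 * (spinAt a' ρ' * spinAt a'' ρ') := by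
      intro a'
      rw [Fintype.sum_eq_add_sum_subtype_ne _ b, hsb, hsa]
      congr 1
      exact Fintype.sum_congr _ _ fun a'' => by rw [hsa]
    simp_rw [hinner, hsb, hsa]
    rw [Finset.sum_add_distrib, hs2, mul_one, mul_sum]
    have h3 : ∀ a' : {x // x ≠ b}, c b a'.1 * (((s : ℤ) : ℝ) * spinAt a' ρ') +
        c a'.1 b * (spinAt a' ρ' * ((s : ℤ) : ℝ)) =
        ((s : ℤ) : ℝ) * ((c b a'.1 + c a'.1 b) * spinAt a' ρ') := fun a' => by ring
    rw [← Finset.sum_congr rfl fun a' _ => h3 a', Finset.sum_add_distrib]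
    ring
  rw [hF]
  dsimp only
  rw [hfield, weight, weight, hcoup]
  push_cast
  simp only [← Complex.exp_add]
  congr 1
  have h4 : ∀ a' : {x // x ≠ b},
      (h a'.1 + ((s : ℤ) : ℂ) * ((c b a'.1 : ℂ) + (c a'.1 b : ℂ))) * (spinAt a' ρ' : ℂ) =
        h a'.1 * (spinAt a' ρ' : ℂ) +
          ((s : ℤ) : ℂ) * (((c b a'.1 : ℂ) + (c a'.1 b : ℂ)) * (spinAt a' ρ' : ℂ)) := fun a' => by
    ring
  simp_rw [h4]
  rw [sum_add_distrib, ← mul_sum]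
  ring

/-- **Lee–Yang for a pinned site.** With `σ_b = +1` pinned, the sum does not vanish for `c ≥ 0`
and fields with `Re h_a > 0` or `h_a = 0` (`a ≠ b`; `h_b` arbitrary): the pinned spin is a
non-negative real field on the other sites. [cite: LiebSokal1981, §3, Cor. 3.3] -/
theorem sum_filter_spin_one_ne_zero {c : ι → ι → ℝ} (hc : ∀ a b, 0 ≤ c a b) (h : ι → ℂ)
    (b : ι) (hh : ∀ a, a ≠ b → (0 < (h a).re ∨ h a = 0)) :
    (∑ ρ ∈ univ.filter (fun ρ : SpinConfig ι => ρ b = 1),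
        exp (∑ a, h a * (spinAt a ρ : ℂ)) * (weight c ρ : ℂ)) ≠ 0 := by
  rw [sum_filter_spin_eq]
  refine mul_ne_zero (exp_ne_zero _) ?_
  refine sum_exp_fields_weight_ne_zero (fun a' a'' => hc _ _) _ fun a' => ?_
  have hcc : 0 ≤ c b a'.1 + c a'.1 b := add_nonneg (hc _ _) (hc _ _)
  rcases hh a'.1 a'.2 with hpos | hzero
  · left
    simp only [Units.val_one, Int.cast_one, one_mul, add_re, ofReal_re]
    linarith
  · rcases hcc.lt_or_eq with hlt | heq
    · left
      simp only [hzero, Units.val_one, Int.cast_one, one_mul, zero_add, ofReal_re]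
      exact hlt
    · right
      simp [hzero, ← heq]

/-! ### 3. `|Z_{b,-}| ≤ |Z_{b,+}|` on the closed Lee–Yang region -/

/-- The configurations with `σ_b ≠ 1` are those with `σ_b = -1`. [folklore] -/
theorem filter_spin_ne_one (b : ι) :
    (univ.filter fun ρ : SpinConfig ι => ¬ρ b = 1) = univ.filter fun ρ : SpinConfig ι => ρ b = -1 := by
  ext ρ
  simp only [mem_filter, mem_univ, true_and]
  rcases Int.units_eq_one_or (ρ b) with h1 | h1 <;> simp [h1]

/-- Splitting `Σ_σ exp(Σ_a h_a σ_a) w_c(σ)` according to the value of `σ_b`. [folklore] -/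
theorem sum_exp_fields_weight_eq_add (c : ι → ι → ℝ) (h : ι → ℂ) (b : ι) :
    (∑ ρ : SpinConfig ι, exp (∑ a, h a * (spinAt a ρ : ℂ)) * (weight c ρ : ℂ)) =
      (∑ ρ ∈ univ.filter (fun ρ : SpinConfig ι => ρ b = 1),
          exp (∑ a, h a * (spinAt a ρ : ℂ)) * (weight c ρ : ℂ)) +
        ∑ ρ ∈ univ.filter (fun ρ : SpinConfig ι => ρ b = -1),
          exp (∑ a, h a * (spinAt a ρ : ℂ)) * (weight c ρ : ℂ) := by
  rw [← filter_spin_ne_one b]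
  exact (sum_filter_add_sum_filter_not _ _ _).symm

/-- Changing the field at `b` rescales the `σ_b = s` part by `exp((h'_b - h_b) s)`. [folklore] -/
theorem sum_filter_spin_update (c : ι → ι → ℝ) (h : ι → ℂ) (b : ι) (t : ℂ) (s : ℤˣ) :
    (∑ ρ ∈ univ.filter (fun ρ : SpinConfig ι => ρ b = s),
        exp (∑ a, Function.update h b t a * (spinAt a ρ : ℂ)) * (weight c ρ : ℂ)) =
      exp ((t - h b) * ((s : ℤ) : ℂ)) *
        ∑ ρ ∈ univ.filter (fun ρ : SpinConfig ι => ρ b = s),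
          exp (∑ a, h a * (spinAt a ρ : ℂ)) * (weight c ρ : ℂ) := by
  rw [mul_sum]
  refine sum_congr rfl fun ρ hρ => ?_
  have hb : ρ b = s := (mem_filter.1 hρ).2
  have hsb : (spinAt b ρ : ℂ) = ((s : ℤ) : ℂ) := by
    rw [spinAt, hb]; push_cast; rfl
  have hsum : (∑ a, Function.update h b t a * (spinAt a ρ : ℂ)) =
      (t - h b) * ((s : ℤ) : ℂ) + ∑ a, h a * (spinAt a ρ : ℂ) := by
    have hdiff : (∑ a, Function.update h b t a * (spinAt a ρ : ℂ)) -
        ∑ a, h a * (spinAt a ρ : ℂ) = (t - h b) * ((s : ℤ) : ℂ) := by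
      rw [← sum_sub_distrib, Finset.sum_eq_single b]
      · rw [Function.update_self, hsb]; ring
      · intro a _ hab
        rw [Function.update_of_ne hab]; ring
      · intro hb'; exact absurd (mem_univ b) hb'
    linear_combination hdiff
  rw [hsum, exp_add, mul_assoc]

/-- **`|Z_{b,-}(h)| ≤ |Z_{b,+}(h)|`, open region.** For `c ≥ 0` and fields with `Re h_a > 0` or
`h_a = 0` at every site, the `σ_b = -1` part of the Lee–Yang sum is dominated in modulus by the
`σ_b = +1` part (the zero of `t ↦ Z(h_b := t) = e^{t} W_+ + e^{-t} W_-` lies in `Re t ≤ 0` by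
Lee–Yang, and `W_+ ≠ 0` by Lee–Yang for the pinned system). [cite: LiebSokal1981, §3]
[cite: Newman1975, Thm 1] -/
theorem norm_sum_filter_neg_le_of_pos {c : ι → ι → ℝ} (hc : ∀ a b, 0 ≤ c a b) (h : ι → ℂ)
    (hh : ∀ a, 0 < (h a).re ∨ h a = 0) (b : ι) :
    ‖∑ ρ ∈ univ.filter (fun ρ : SpinConfig ι => ρ b = -1),
        exp (∑ a, h a * (spinAt a ρ : ℂ)) * (weight c ρ : ℂ)‖ ≤
      ‖∑ ρ ∈ univ.filter (fun ρ : SpinConfig ι => ρ b = 1),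
        exp (∑ a, h a * (spinAt a ρ : ℂ)) * (weight c ρ : ℂ)‖ := by
  classical
  -- the pinned parts with the field at `b` removed
  set h₀ : ι → ℂ := Function.update h b 0 with hh₀
  set Wp : ℂ := ∑ ρ ∈ univ.filter (fun ρ : SpinConfig ι => ρ b = 1),
      exp (∑ a, h₀ a * (spinAt a ρ : ℂ)) * (weight c ρ : ℂ) with hWp
  set Wm : ℂ := ∑ ρ ∈ univ.filter (fun ρ : SpinConfig ι => ρ b = -1),
      exp (∑ a, h₀ a * (spinAt a ρ : ℂ)) * (weight c ρ : ℂ) with hWm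
  have hh₀a : ∀ a, a ≠ b → h₀ a = h a := fun a hab => by rw [hh₀, Function.update_of_ne hab]
  have hh₀b : h₀ b = 0 := by rw [hh₀, Function.update_self]
  clear_value h₀
  -- `Z(h_b := t) = e^t W_+ + e^{-t} W_-`
  have hZt : ∀ t : ℂ, (∑ ρ : SpinConfig ι,
      exp (∑ a, Function.update h₀ b t a * (spinAt a ρ : ℂ)) * (weight c ρ : ℂ)) =
      exp t * Wp + exp (-t) * Wm := by
    intro t
    rw [sum_exp_fields_weight_eq_add _ _ b, sum_filter_spin_update, sum_filter_spin_update, hh₀b]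
    simp only [sub_zero, Units.val_one, Units.val_neg, Int.cast_one, Int.cast_neg, mul_one,
      mul_neg_one]
    rw [hWp, hWm]
  -- Lee–Yang for the full system with `Re t > 0`
  have hLY : ∀ t : ℂ, 0 < t.re → exp t * Wp + exp (-t) * Wm ≠ 0 := by
    intro t ht
    rw [← hZt t]
    refine sum_exp_fields_weight_ne_zero hc _ fun a => ?_
    by_cases hab : a = b
    · left; rw [hab, Function.update_self]; exact ht
    · rw [Function.update_of_ne hab, hh₀a a hab]; exact hh a
  -- Lee–Yang for the pinned system: `W_+ ≠ 0`
  have hWp0 : Wp ≠ 0 := by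
    refine sum_filter_spin_one_ne_zero hc h₀ b fun a hab => ?_
    rw [hh₀a a hab]; exact hh a
  -- hence `‖W_-‖ ≤ ‖W_+‖`
  have hW : ‖Wm‖ ≤ ‖Wp‖ := by
    by_contra hlt
    push Not at hlt
    have hWm0 : Wm ≠ 0 := by
      intro h0; rw [h0, norm_zero] at hlt; exact (norm_nonneg Wp).not_gt hlt
    set q : ℂ := -Wm / Wp with hq
    have hq0 : q ≠ 0 := div_ne_zero (neg_ne_zero.2 hWm0) hWp0
    have hq1 : 1 < ‖q‖ := by
      rw [hq, norm_div, norm_neg, one_lt_div (norm_pos_iff.2 hWp0)]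
      exact hlt
    set t : ℂ := log q / 2 with ht
    have ht2 : exp (2 * t) = q := by
      rw [ht, mul_div_cancel₀ _ (two_ne_zero' ℂ), exp_log hq0]
    have htre : 0 < t.re := by
      rw [ht]
      have : (log q / 2).re = Real.log ‖q‖ / 2 := by simp [log_re]
      rw [this]
      exact div_pos (Real.log_pos hq1) two_pos
    have hzero : exp t * Wp + exp (-t) * Wm = 0 := by
      have hexp : exp t = exp (-t) * exp (2 * t) := by rw [← exp_add]; ring_nf
      rw [hexp, ht2, hq]
      field_simp
      ring
    exact hLY t htre hzero
  -- reinsert the field at `b`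
  have hp : (∑ ρ ∈ univ.filter (fun ρ : SpinConfig ι => ρ b = 1),
      exp (∑ a, h a * (spinAt a ρ : ℂ)) * (weight c ρ : ℂ)) = exp (h b) * Wp := by
    have := sum_filter_spin_update c h₀ b (h b) 1
    rw [hh₀b, sub_zero] at this
    simp only [Units.val_one, Int.cast_one, mul_one] at this
    rw [← this]
    refine sum_congr rfl fun ρ _ => ?_
    congr 2
    refine sum_congr rfl fun a _ => ?_
    by_cases hab : a = b
    · rw [hab, Function.update_self]
    · rw [Function.update_of_ne hab, hh₀a a hab]
  have hm : (∑ ρ ∈ univ.filter (fun ρ : SpinConfig ι => ρ b = -1),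
      exp (∑ a, h a * (spinAt a ρ : ℂ)) * (weight c ρ : ℂ)) = exp (-h b) * Wm := by
    have := sum_filter_spin_update c h₀ b (h b) (-1)
    rw [hh₀b, sub_zero] at this
    simp only [Units.val_neg, Units.val_one, Int.cast_neg, Int.cast_one, mul_neg, mul_one] at this
    rw [← this]
    refine sum_congr rfl fun ρ _ => ?_
    congr 2
    refine sum_congr rfl fun a _ => ?_
    by_cases hab : a = b
    · rw [hab, Function.update_self]
    · rw [Function.update_of_ne hab, hh₀a a hab]
  have hre : 0 ≤ (h b).re := by
    rcases hh b with hpos | hzero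
    · exact hpos.le
    · rw [hzero]; simp
  rw [hp, hm, norm_mul, norm_mul, Complex.norm_exp, Complex.norm_exp, neg_re]
  have h1 : Real.exp (-(h b).re) ≤ Real.exp (h b).re := Real.exp_le_exp.2 (by linarith)
  exact mul_le_mul h1 hW (norm_nonneg _) (Real.exp_pos _).le

/-- **`|Z_{b,-}(h)| ≤ |Z_{b,+}(h)|` on the CLOSED region `Re h ≥ 0`** (in particular at purely
imaginary fields), by continuity from `h + ε`, `ε → 0⁺`.  Equivalently `Re ⟨σ_b⟩_h ≥ 0` wherever
`Z(h) ≠ 0`. [cite: LiebSokal1981, §3] [cite: Newman1975, Thm 1] -/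
theorem norm_sum_filter_neg_le {c : ι → ι → ℝ} (hc : ∀ a b, 0 ≤ c a b) (h : ι → ℂ)
    (hh : ∀ a, 0 ≤ (h a).re) (b : ι) :
    ‖∑ ρ ∈ univ.filter (fun ρ : SpinConfig ι => ρ b = -1),
        exp (∑ a, h a * (spinAt a ρ : ℂ)) * (weight c ρ : ℂ)‖ ≤
      ‖∑ ρ ∈ univ.filter (fun ρ : SpinConfig ι => ρ b = 1),
        exp (∑ a, h a * (spinAt a ρ : ℂ)) * (weight c ρ : ℂ)‖ := by
  -- `g ε = ‖Z_{b,+}(h+ε)‖ - ‖Z_{b,-}(h+ε)‖` is continuous and `≥ 0` for `ε > 0`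
  set Zs : ℝ → ℤˣ → ℂ := fun ε s => ∑ ρ ∈ univ.filter (fun ρ : SpinConfig ι => ρ b = s),
      exp (∑ a, (h a + (ε : ℂ)) * (spinAt a ρ : ℂ)) * (weight c ρ : ℂ) with hZs
  have hcont : ∀ s : ℤˣ, Continuous fun ε : ℝ => Zs ε s := by
    intro s
    simp only [hZs]
    refine continuous_finsetSum _ fun ρ _ => Continuous.mul ?_ continuous_const
    refine Continuous.cexp (continuous_finsetSum _ fun a _ => ?_)
    exact (continuous_const.add Complex.continuous_ofReal).mul continuous_const
  set g : ℝ → ℝ := fun ε => ‖Zs ε 1‖ - ‖Zs ε (-1)‖ with hg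
  have hgcont : Continuous g := ((hcont 1).norm).sub ((hcont (-1)).norm)
  have hgpos : ∀ ε : ℝ, 0 < ε → 0 ≤ g ε := by
    intro ε hε
    have key := norm_sum_filter_neg_le_of_pos hc (fun a => h a + (ε : ℂ))
      (fun a => Or.inl (by simp only [add_re, ofReal_re]; linarith [hh a])) b
    simp only [hg]
    linarith [key]
  have hlim : Filter.Tendsto g (nhdsWithin 0 (Set.Ioi 0)) (nhds (g 0)) :=
    hgcont.continuousAt.tendsto.mono_left nhdsWithin_le_nhds
  have hev : ∀ᶠ ε in nhdsWithin (0 : ℝ) (Set.Ioi 0), (0 : ℝ) ≤ g ε :=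
    eventually_nhdsWithin_of_forall fun ε hε => hgpos ε hε
  have hg0 : 0 ≤ g 0 := ge_of_tendsto hlim hev
  have hZ0 : ∀ s : ℤˣ, Zs 0 s = ∑ ρ ∈ univ.filter (fun ρ : SpinConfig ι => ρ b = s),
      exp (∑ a, h a * (spinAt a ρ : ℂ)) * (weight c ρ : ℂ) := by
    intro s; simp [hZs]
  simp only [hg, hZ0] at hg0
  linarith

/-! ### 4. Phase monotonicity of the tilted sum `Σ e^{σ_a} w e^{iθX}` -/

section Phase

variable (c : ι → ι → ℝ) (lam : ι → ℝ) (a : ι)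

/-- `Σ_x h^θ_x σ_x = iθX + σ_a` for the fields `h^θ_x = iθλ_x + 𝟙[x = a]`. [folklore] -/
theorem sum_tiltField_mul_spin (θ : ℝ) (ρ : SpinConfig ι) :
    (∑ x, ((((θ * lam x : ℝ) : ℂ) * I + if x = a then (1 : ℂ) else 0) * (spinAt x ρ : ℂ))) =
      ((θ * weightedMagnetization lam ρ : ℝ) : ℂ) * I + (spinAt a ρ : ℂ) := by
  simp only [add_mul, sum_add_distrib, ite_mul, one_mul, zero_mul, Finset.sum_ite_eq', mem_univ,
    if_true]
  congr 1
  unfold weightedMagnetization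
  push_cast
  rw [mul_sum, sum_mul]
  exact sum_congr rfl fun x _ => by ring

/-- The tilted Lee–Yang sum in trigonometric form:
`Σ_σ exp(iθX + σ_a) w = Σ e^{σ_a} w cos(θX) + i Σ e^{σ_a} w sin(θX)`. [folklore] -/
theorem sum_exp_tiltField_eq (θ : ℝ) :
    (∑ ρ : SpinConfig ι, exp (∑ x, ((((θ * lam x : ℝ) : ℂ) * I + if x = a then (1 : ℂ) else 0) *
        (spinAt x ρ : ℂ))) * (weight c ρ : ℂ)) =
      ((∑ ρ : SpinConfig ι, Real.exp (spinAt a ρ) * weight c ρ *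
          Real.cos (θ * weightedMagnetization lam ρ) : ℝ) : ℂ) +
        ((∑ ρ : SpinConfig ι, Real.exp (spinAt a ρ) * weight c ρ *
          Real.sin (θ * weightedMagnetization lam ρ) : ℝ) : ℂ) * I := by
  simp_rw [sum_tiltField_mul_spin]
  push_cast
  rw [sum_mul, ← sum_add_distrib]
  refine sum_congr rfl fun ρ _ => ?_
  rw [exp_add, exp_mul_I]
  ring

/-- Its `θ`-derivative sum in trigonometric form:
`Σ_σ iX exp(iθX + σ_a) w = -Σ e^{σ_a} w X sin(θX) + i Σ e^{σ_a} w X cos(θX)`. [folklore] -/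
theorem sum_deriv_exp_tiltField_eq (θ : ℝ) :
    (∑ ρ : SpinConfig ι, (I * (weightedMagnetization lam ρ : ℂ)) *
        (exp (∑ x, ((((θ * lam x : ℝ) : ℂ) * I + if x = a then (1 : ℂ) else 0) *
          (spinAt x ρ : ℂ))) * (weight c ρ : ℂ))) =
      ((∑ ρ : SpinConfig ι, Real.exp (spinAt a ρ) * weight c ρ *
          (-(weightedMagnetization lam ρ * Real.sin (θ * weightedMagnetization lam ρ))) : ℝ) : ℂ) +
        ((∑ ρ : SpinConfig ι, Real.exp (spinAt a ρ) * weight c ρ *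
          (weightedMagnetization lam ρ * Real.cos (θ * weightedMagnetization lam ρ)) : ℝ) : ℂ) *
            I := by
  simp_rw [sum_tiltField_mul_spin]
  push_cast
  rw [sum_mul, ← sum_add_distrib]
  refine sum_congr rfl fun ρ _ => ?_
  rw [exp_add, exp_mul_I]
  have hI : I * I = -1 := I_mul_I
  linear_combination (exp (spinAt a ρ : ℂ) * (weight c ρ : ℂ) *
    (weightedMagnetization lam ρ : ℂ) * Complex.sin ((θ : ℂ) * (weightedMagnetization lam ρ : ℂ))) * hI

/-- `Σ_σ σ_x F(σ)` splits as the `σ_x = +1` part minus the `σ_x = -1` part. [folklore] -/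
theorem sum_spin_mul_eq_sub (F : SpinConfig ι → ℂ) (x : ι) :
    (∑ ρ : SpinConfig ι, (spinAt x ρ : ℂ) * F ρ) =
      (∑ ρ ∈ univ.filter (fun ρ : SpinConfig ι => ρ x = 1), F ρ) -
        ∑ ρ ∈ univ.filter (fun ρ : SpinConfig ι => ρ x = -1), F ρ := by
  rw [← sum_filter_add_sum_filter_not univ (fun ρ : SpinConfig ι => ρ x = 1), filter_spin_ne_one x,
    sub_eq_add_neg, ← sum_neg_distrib]
  congr 1
  · refine sum_congr rfl fun ρ hρ => ?_
    have h1 : ρ x = 1 := (mem_filter.1 hρ).2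
    simp [spinAt, h1]
  · refine sum_congr rfl fun ρ hρ => ?_
    have h1 : ρ x = -1 := (mem_filter.1 hρ).2
    simp [spinAt, h1]

/-- **The Wronskian of the tilted sums is non-negative** (`V'U - U'V ≥ 0` with
`U + iV = Σ e^{σ_a} w e^{iθX}`): it equals `Σ_x λ_x (|A_x|² - |B_x|²)` with `A_x, B_x` the
`σ_x = ±1` parts of the tilted Lee–Yang sum, and `|B_x| ≤ |A_x|` (`norm_sum_filter_neg_le`).  This
is `d/dθ arg Σ e^{σ_a} w e^{iθX} ≥ 0`, i.e. `Σ_x λ_x Re⟨σ_x⟩ ≥ 0` at the fields `iθλ + 𝟙_a`.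
[cite: Newman1975, Thm 1] [cite: LiebSokal1981, §3] -/
theorem wronskian_tilt_nonneg {c : ι → ι → ℝ} (hc : ∀ a b, 0 ≤ c a b) {lam : ι → ℝ}
    (hlam : ∀ x, 0 ≤ lam x) (a : ι) (θ : ℝ) :
    0 ≤ (∑ ρ : SpinConfig ι, Real.exp (spinAt a ρ) * weight c ρ *
          (weightedMagnetization lam ρ * Real.cos (θ * weightedMagnetization lam ρ))) *
        (∑ ρ : SpinConfig ι, Real.exp (spinAt a ρ) * weight c ρ *
          Real.cos (θ * weightedMagnetization lam ρ)) -
      (∑ ρ : SpinConfig ι, Real.exp (spinAt a ρ) * weight c ρ *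
          (-(weightedMagnetization lam ρ * Real.sin (θ * weightedMagnetization lam ρ)))) *
        (∑ ρ : SpinConfig ι, Real.exp (spinAt a ρ) * weight c ρ *
          Real.sin (θ * weightedMagnetization lam ρ)) := by
  classical
  -- the fields and the complex sums
  set hθ : ι → ℂ := fun x => ((θ * lam x : ℝ) : ℂ) * I + if x = a then (1 : ℂ) else 0 with hhθ
  have hre : ∀ x, 0 ≤ (hθ x).re := by
    intro x
    simp only [hhθ, add_re, mul_re, ofReal_re, I_re, mul_zero, ofReal_im, I_im, mul_one,
      sub_self, zero_add]
    split_ifs <;> simp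
  set F : SpinConfig ι → ℂ := fun ρ => exp (∑ x, hθ x * (spinAt x ρ : ℂ)) * (weight c ρ : ℂ)
    with hF
  set Ec : ℂ := ∑ ρ, F ρ with hEc
  set Epc : ℂ := ∑ ρ, (I * (weightedMagnetization lam ρ : ℂ)) * F ρ with hEpc
  set A : ι → ℂ := fun x => ∑ ρ ∈ univ.filter (fun ρ : SpinConfig ι => ρ x = 1), F ρ with hA
  set B : ι → ℂ := fun x => ∑ ρ ∈ univ.filter (fun ρ : SpinConfig ι => ρ x = -1), F ρ with hB
  have hAB : ∀ x, Ec = A x + B x := fun x => sum_exp_fields_weight_eq_add c hθ x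
  have hBA : ∀ x, ‖B x‖ ≤ ‖A x‖ := fun x => norm_sum_filter_neg_le hc hθ hre x
  -- `E' = i Σ_x λ_x (A_x - B_x)`
  have hEpc' : Epc = I * ∑ x, (lam x : ℂ) * (A x - B x) := by
    have h1 : ∀ ρ : SpinConfig ι, (I * (weightedMagnetization lam ρ : ℂ)) * F ρ =
        I * ∑ x, (lam x : ℂ) * ((spinAt x ρ : ℂ) * F ρ) := by
      intro ρ
      unfold weightedMagnetization
      push_cast
      rw [mul_assoc, sum_mul]
      congr 1
      exact sum_congr rfl fun x _ => by ring
    simp_rw [hEpc, h1]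
    rw [← mul_sum, Finset.sum_comm]
    congr 1
    refine sum_congr rfl fun x _ => ?_
    rw [← mul_sum, sum_spin_mul_eq_sub]
  -- `Im(E' conj E) = Σ_x λ_x (|A_x|² - |B_x|²) ≥ 0`
  have him : 0 ≤ (Epc * (starRingEnd ℂ) Ec).im := by
    have h2 : Epc * (starRingEnd ℂ) Ec =
        I * ∑ x, (lam x : ℂ) * ((A x - B x) * ((starRingEnd ℂ) (A x) + (starRingEnd ℂ) (B x))) := by
      rw [hEpc', mul_assoc, sum_mul]
      congr 1
      refine sum_congr rfl fun x _ => ?_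
      rw [hAB x, map_add]
      ring
    rw [h2, I_mul_im, re_sum]
    refine sum_nonneg fun x _ => ?_
    have h3 : ((lam x : ℂ) * ((A x - B x) * ((starRingEnd ℂ) (A x) + (starRingEnd ℂ) (B x)))).re =
        lam x * (‖A x‖ ^ 2 - ‖B x‖ ^ 2) := by
      rw [← Complex.normSq_eq_norm_sq, ← Complex.normSq_eq_norm_sq, Complex.normSq_apply,
        Complex.normSq_apply]
      simp only [mul_re, sub_re, add_re, sub_im, add_im, conj_re, conj_im, ofReal_re, ofReal_im]
      ring
    rw [h3]
    refine mul_nonneg (hlam x) ?_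
    have := hBA x
    nlinarith [norm_nonneg (A x), norm_nonneg (B x)]
  -- `Im(E' conj E) = V'U - U'V`
  have hEc2 : Ec = _ := sum_exp_tiltField_eq c lam a θ
  have hEpc2 : Epc = _ := sum_deriv_exp_tiltField_eq c lam a θ
  rw [hEc2, hEpc2] at him
  simp only [map_add, map_mul, conj_ofReal, conj_I, mul_im, add_re, add_im, mul_re, ofReal_re,
    ofReal_im, I_re, I_im, neg_re, neg_im, neg_zero, mul_zero, add_zero, zero_add,
    sub_zero, mul_one, mul_neg_one] at him
  linarith [him]

end Phase

/-! ### 5. `Im ⟨σ_a⟩_{iθλ} ≥ 0` on the Lee–Yang star -/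

section Star

omit [DecidableEq ι] in
/-- Spin flip leaves the Boltzmann weight invariant (local copy). [folklore] -/
private theorem weight_neg'' (c : ι → ι → ℝ) (ρ : SpinConfig ι) : weight c (-ρ) = weight c ρ := by
  unfold weight
  simp [spinAt_neg]

omit [DecidableEq ι] in
/-- Spin flip reverses the weighted magnetisation (local copy). [folklore] -/
private theorem weightedMagnetization_neg'' (lam : ι → ℝ) (ρ : SpinConfig ι) :
    weightedMagnetization lam (-ρ) = -weightedMagnetization lam ρ := by
  unfold weightedMagnetization
  simp [spinAt_neg, sum_neg_distrib]

/-- `Σ_σ σ_a cos(θX) w = 0` (odd under the spin flip). [folklore] -/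
theorem sum_spin_mul_cos_weight_eq_zero (c : ι → ι → ℝ) (lam : ι → ℝ) (a : ι) (θ : ℝ) :
    (∑ ρ : SpinConfig ι, spinAt a ρ * Real.cos (θ * weightedMagnetization lam ρ) * weight c ρ) = 0 := by
  have h := Fintype.sum_equiv (Equiv.neg (SpinConfig ι))
    (fun ρ => spinAt a ρ * Real.cos (θ * weightedMagnetization lam ρ) * weight c ρ)
    (fun ρ => -(spinAt a ρ * Real.cos (θ * weightedMagnetization lam ρ) * weight c ρ))
    (fun ρ => by
      simp only [Equiv.neg_apply, spinAt_neg, weightedMagnetization_neg'', weight_neg'', mul_neg,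
        Real.cos_neg, neg_mul, neg_neg])
  rw [sum_neg_distrib] at h
  linarith

/-- `Σ_σ sin(θX) w = 0` (odd under the spin flip). [folklore] -/
theorem sum_sin_weight_eq_zero (c : ι → ι → ℝ) (lam : ι → ℝ) (θ : ℝ) :
    (∑ ρ : SpinConfig ι, Real.sin (θ * weightedMagnetization lam ρ) * weight c ρ) = 0 := by
  have h := Fintype.sum_equiv (Equiv.neg (SpinConfig ι))
    (fun ρ => Real.sin (θ * weightedMagnetization lam ρ) * weight c ρ)
    (fun ρ => -(Real.sin (θ * weightedMagnetization lam ρ) * weight c ρ))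
    (fun ρ => by
      simp only [Equiv.neg_apply, weightedMagnetization_neg'', weight_neg'', mul_neg, Real.sin_neg,
        neg_mul, neg_neg])
  rw [sum_neg_distrib] at h
  linarith

omit [Fintype ι] [DecidableEq ι] in
/-- `e^{σ_a} = cosh 1 + σ_a sinh 1`. [folklore] -/
theorem exp_spinAt (a : ι) (ρ : SpinConfig ι) :
    Real.exp (spinAt a ρ) = Real.cosh 1 + spinAt a ρ * Real.sinh 1 := by
  rcases spinAt_eq_one_or_eq_neg_one a ρ with h | h
  · rw [h, Real.cosh_eq, Real.sinh_eq]; ring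
  · rw [h, Real.cosh_eq, Real.sinh_eq]; ring

/-- The tilted cosine sum is `cosh 1 · Σ cos(θX) w`. [folklore] -/
theorem tilt_cos_sum_eq (c : ι → ι → ℝ) (lam : ι → ℝ) (a : ι) (θ : ℝ) :
    (∑ ρ : SpinConfig ι, Real.exp (spinAt a ρ) * weight c ρ *
        Real.cos (θ * weightedMagnetization lam ρ)) =
      Real.cosh 1 * ∑ ρ : SpinConfig ι, Real.cos (θ * weightedMagnetization lam ρ) * weight c ρ := by
  have h0 := sum_spin_mul_cos_weight_eq_zero c lam a θ
  simp_rw [exp_spinAt]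
  have : ∀ ρ : SpinConfig ι, (Real.cosh 1 + spinAt a ρ * Real.sinh 1) * weight c ρ *
      Real.cos (θ * weightedMagnetization lam ρ) =
      Real.cosh 1 * (Real.cos (θ * weightedMagnetization lam ρ) * weight c ρ) +
        Real.sinh 1 * (spinAt a ρ * Real.cos (θ * weightedMagnetization lam ρ) * weight c ρ) :=
    fun ρ => by ring
  simp_rw [this]
  rw [sum_add_distrib, ← mul_sum, ← mul_sum, h0, mul_zero, add_zero]

/-- The tilted sine sum is `sinh 1 · Σ σ_a sin(θX) w`. [folklore] -/
theorem tilt_sin_sum_eq (c : ι → ι → ℝ) (lam : ι → ℝ) (a : ι) (θ : ℝ) :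
    (∑ ρ : SpinConfig ι, Real.exp (spinAt a ρ) * weight c ρ *
        Real.sin (θ * weightedMagnetization lam ρ)) =
      Real.sinh 1 * ∑ ρ : SpinConfig ι,
        spinAt a ρ * Real.sin (θ * weightedMagnetization lam ρ) * weight c ρ := by
  have h0 := sum_sin_weight_eq_zero c lam θ
  simp_rw [exp_spinAt]
  have : ∀ ρ : SpinConfig ι, (Real.cosh 1 + spinAt a ρ * Real.sinh 1) * weight c ρ *
      Real.sin (θ * weightedMagnetization lam ρ) =
      Real.cosh 1 * (Real.sin (θ * weightedMagnetization lam ρ) * weight c ρ) +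
        Real.sinh 1 * (spinAt a ρ * Real.sin (θ * weightedMagnetization lam ρ) * weight c ρ) :=
    fun ρ => by ring
  simp_rw [this]
  rw [sum_add_distrib, ← mul_sum, ← mul_sum, h0, mul_zero, zero_add]

/-- `θ`-derivative of the tilted cosine sum. [folklore] -/
theorem hasDerivAt_tilt_cos_sum (c : ι → ι → ℝ) (lam : ι → ℝ) (a : ι) (θ : ℝ) :
    HasDerivAt (fun θ' : ℝ => ∑ ρ : SpinConfig ι, Real.exp (spinAt a ρ) * weight c ρ *
        Real.cos (θ' * weightedMagnetization lam ρ))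
      (∑ ρ : SpinConfig ι, Real.exp (spinAt a ρ) * weight c ρ *
        (-(weightedMagnetization lam ρ * Real.sin (θ * weightedMagnetization lam ρ)))) θ := by
  refine HasDerivAt.fun_sum fun ρ _ => ?_
  have h := ((Real.hasDerivAt_cos (θ * weightedMagnetization lam ρ)).comp θ
    ((hasDerivAt_id θ).mul_const (weightedMagnetization lam ρ))).const_mul
    (Real.exp (spinAt a ρ) * weight c ρ)
  refine h.congr_deriv ?_
  ring

/-- `θ`-derivative of the tilted sine sum. [folklore] -/
theorem hasDerivAt_tilt_sin_sum (c : ι → ι → ℝ) (lam : ι → ℝ) (a : ι) (θ : ℝ) :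
    HasDerivAt (fun θ' : ℝ => ∑ ρ : SpinConfig ι, Real.exp (spinAt a ρ) * weight c ρ *
        Real.sin (θ' * weightedMagnetization lam ρ))
      (∑ ρ : SpinConfig ι, Real.exp (spinAt a ρ) * weight c ρ *
        (weightedMagnetization lam ρ * Real.cos (θ * weightedMagnetization lam ρ))) θ := by
  refine HasDerivAt.fun_sum fun ρ _ => ?_
  have h := ((Real.hasDerivAt_sin (θ * weightedMagnetization lam ρ)).comp θ
    ((hasDerivAt_id θ).mul_const (weightedMagnetization lam ρ))).const_mul
    (Real.exp (spinAt a ρ) * weight c ρ)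
  refine h.congr_deriv ?_
  ring

/-- **Positivity of the tilted sine sum** while the tilted cosine sum stays positive: the
quotient `V/U` has derivative `(V'U - U'V)/U² ≥ 0` (`wronskian_tilt_nonneg`) and vanishes at `0`.
[cite: Newman1975, Thm 1] -/
theorem tilt_sin_sum_nonneg {c : ι → ι → ℝ} (hc : ∀ a b, 0 ≤ c a b) {lam : ι → ℝ}
    (hlam : ∀ x, 0 ≤ lam x) (a : ι) {θ₁ : ℝ} (hθ₁ : 0 ≤ θ₁)
    (hU : ∀ θ ∈ Set.Icc (0 : ℝ) θ₁, 0 < ∑ ρ : SpinConfig ι, Real.exp (spinAt a ρ) * weight c ρ *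
        Real.cos (θ * weightedMagnetization lam ρ)) :
    0 ≤ ∑ ρ : SpinConfig ι, Real.exp (spinAt a ρ) * weight c ρ *
        Real.sin (θ₁ * weightedMagnetization lam ρ) := by
  set U : ℝ → ℝ := fun θ => ∑ ρ : SpinConfig ι, Real.exp (spinAt a ρ) * weight c ρ *
    Real.cos (θ * weightedMagnetization lam ρ) with hUdef
  set V : ℝ → ℝ := fun θ => ∑ ρ : SpinConfig ι, Real.exp (spinAt a ρ) * weight c ρ *
    Real.sin (θ * weightedMagnetization lam ρ) with hVdef
  set U' : ℝ → ℝ := fun θ => ∑ ρ : SpinConfig ι, Real.exp (spinAt a ρ) * weight c ρ *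
    (-(weightedMagnetization lam ρ * Real.sin (θ * weightedMagnetization lam ρ))) with hU'def
  set V' : ℝ → ℝ := fun θ => ∑ ρ : SpinConfig ι, Real.exp (spinAt a ρ) * weight c ρ *
    (weightedMagnetization lam ρ * Real.cos (θ * weightedMagnetization lam ρ)) with hV'def
  have hUd : ∀ θ, HasDerivAt U (U' θ) θ := fun θ => hasDerivAt_tilt_cos_sum c lam a θ
  have hVd : ∀ θ, HasDerivAt V (V' θ) θ := fun θ => hasDerivAt_tilt_sin_sum c lam a θ
  have hW : ∀ θ, 0 ≤ V' θ * U θ - U' θ * V θ := fun θ => wronskian_tilt_nonneg hc hlam a θ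
  -- the quotient `q = V/U` on `[0, θ₁]`
  set q : ℝ → ℝ := fun θ => V θ / U θ with hqdef
  have hqd : ∀ θ ∈ Set.Icc (0 : ℝ) θ₁,
      HasDerivAt q ((V' θ * U θ - V θ * U' θ) / (U θ) ^ 2) θ :=
    fun θ hθ => (hVd θ).div (hUd θ) (hU θ hθ).ne'
  have hmono : MonotoneOn q (Set.Icc 0 θ₁) := by
    refine monotoneOn_of_deriv_nonneg (convex_Icc 0 θ₁) ?_ ?_ ?_
    · exact fun θ hθ => (hqd θ hθ).continuousAt.continuousWithinAt
    · intro θ hθ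
      exact (hqd θ (interior_subset hθ)).differentiableAt.differentiableWithinAt
    · intro θ hθ
      rw [(hqd θ (interior_subset hθ)).deriv]
      refine div_nonneg ?_ (sq_nonneg _)
      have := hW θ
      linarith
  have hq0 : q 0 = 0 := by
    simp only [hqdef, hVdef, zero_mul, Real.sin_zero, mul_zero, sum_const_zero, zero_div]
  have hq1 : 0 ≤ q θ₁ := by
    rw [← hq0]
    exact hmono (Set.left_mem_Icc.2 hθ₁) (Set.right_mem_Icc.2 hθ₁) hθ₁
  have hU1 := hU θ₁ (Set.right_mem_Icc.2 hθ₁)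
  have : V θ₁ = q θ₁ * U θ₁ := by
    simp only [hqdef]
    rw [div_mul_cancel₀ _ hU1.ne']
  show 0 ≤ V θ₁
  rw [this]
  exact mul_nonneg hq1 hU1.le

/-- **`Σ σ_a sin(θ₁X) w ≥ 0` if `Σ cos(θX) w > 0` on `[0, θ₁]`** — i.e. `Im ⟨σ_a⟩_{iθ₁λ} ≥ 0` on the
Lee–Yang star (the zeros of `Z` and of `S_a = Z · Im⟨σ_a⟩` interlace; consequence of the Lee–Yang
theorem via the phase monotonicity of the `a`-tilted sum). [cite: Newman1975, Thm 1]
[cite: LiebSokal1981, §3] -/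
theorem sum_spin_mul_sin_weight_nonneg {c : ι → ι → ℝ} (hc : ∀ a b, 0 ≤ c a b) {lam : ι → ℝ}
    (hlam : ∀ x, 0 ≤ lam x) (a : ι) {θ₁ : ℝ} (hθ₁ : 0 ≤ θ₁)
    (hZ : ∀ θ ∈ Set.Icc (0 : ℝ) θ₁,
      0 < ∑ ρ : SpinConfig ι, Real.cos (θ * weightedMagnetization lam ρ) * weight c ρ) :
    0 ≤ ∑ ρ : SpinConfig ι, spinAt a ρ * Real.sin (θ₁ * weightedMagnetization lam ρ) * weight c ρ := by
  have hU : ∀ θ ∈ Set.Icc (0 : ℝ) θ₁, 0 < ∑ ρ : SpinConfig ι, Real.exp (spinAt a ρ) * weight c ρ *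
      Real.cos (θ * weightedMagnetization lam ρ) := by
    intro θ hθ
    rw [tilt_cos_sum_eq]
    exact mul_pos (Real.cosh_pos 1) (hZ θ hθ)
  have h := tilt_sin_sum_nonneg hc hlam a hθ₁ hU
  rw [tilt_sin_sum_eq] at h
  have hsinh : 0 < Real.sinh 1 := Real.sinh_pos_iff.2 one_pos
  by_contra hneg
  push Not at hneg
  have := mul_neg_of_pos_of_neg hsinh hneg
  linarith

/-- **`⟨σ_a sin(θ₁X)⟩_c ≥ 0` at the right end of an interval `[0, θ₁)` on which `⟨cos θX⟩_c > 0`**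
(in particular at the first zero `θ₁` of `⟨cos θX⟩_c`), by continuity from
`sum_spin_mul_sin_weight_nonneg`. [cite: Newman1975, Thm 1] [cite: LiebSokal1981, §3] -/
theorem avg_spin_mul_sin_nonneg {c : ι → ι → ℝ} (hc : ∀ a b, 0 ≤ c a b) {lam : ι → ℝ}
    (hlam : ∀ x, 0 ≤ lam x) (a : ι) {θ₁ : ℝ} (hθ₁ : 0 ≤ θ₁)
    (hpos : ∀ θ ∈ Set.Ico (0 : ℝ) θ₁,
      0 < avg c (fun ρ => Real.cos (θ * weightedMagnetization lam ρ))) :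
    0 ≤ avg c (fun ρ => spinAt a ρ * Real.sin (θ₁ * weightedMagnetization lam ρ)) := by
  have hW : 0 < ∑ ρ : SpinConfig ι, weight c ρ := sum_weight_pos c
  -- on `[0, θ]` for every `θ < θ₁`
  have hθ : ∀ θ ∈ Set.Ico (0 : ℝ) θ₁,
      0 ≤ ∑ ρ : SpinConfig ι, spinAt a ρ * Real.sin (θ * weightedMagnetization lam ρ) * weight c ρ := by
    intro θ hθ
    refine sum_spin_mul_sin_weight_nonneg hc hlam a hθ.1 fun θ' hθ' => ?_
    have h1 := hpos θ' ⟨hθ'.1, hθ'.2.trans_lt hθ.2⟩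
    rw [avg_def] at h1
    exact (div_pos_iff_of_pos_right hW).1 h1
  -- continuity at `θ₁` from the left
  set f : ℝ → ℝ := fun θ => ∑ ρ : SpinConfig ι,
    spinAt a ρ * Real.sin (θ * weightedMagnetization lam ρ) * weight c ρ with hf
  have hcont : Continuous f := by
    refine continuous_finsetSum _ fun ρ _ => ?_
    exact (continuous_const.mul (Real.continuous_sin.comp (continuous_id.mul continuous_const))).mul
      continuous_const
  have hf1 : 0 ≤ f θ₁ := by
    rcases hθ₁.lt_or_eq with hlt | heq
    · have hlim : Filter.Tendsto f (nhdsWithin θ₁ (Set.Iio θ₁)) (nhds (f θ₁)) :=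
        hcont.continuousAt.tendsto.mono_left nhdsWithin_le_nhds
      have hev : ∀ᶠ θ in nhdsWithin θ₁ (Set.Iio θ₁), (0 : ℝ) ≤ f θ := by
        have hmem : Set.Ioo 0 θ₁ ∈ nhdsWithin θ₁ (Set.Iio θ₁) := Ioo_mem_nhdsLT hlt
        filter_upwards [hmem] with θ hθ' using hθ θ ⟨hθ'.1.le, hθ'.2⟩
      exact ge_of_tendsto hlim hev
    · rw [← heq]
      simp [hf]
  rw [avg_def]
  exact div_nonneg hf1 hW.le

end Star

end PairIsing

end Literature.Probability.LatticeModels
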